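import Summits.NavierStokesRegularity.NavierStokesRegularity.Theorems.ScaledTopAlignmentAprioriMostTimesBulkAlignmentStubCoherenceToMostTimes
import HarnessLib

/-!
# Route `ScaledTopAlignment`, crux W3ᵐᵗ = `AprioriMostTimesBulkAlignment` (stmt-NavierStokesRegularity-19551), line
# `birth` (class #2): the WEAKEST POINTWISE form of the physics hypothesis H₂ that still feeds the door — audit result
# of the §C seat ns-sta-19551-p2

The registered physics stub of the class-#2 cut (`stub_singularNearMaxCoherence`, text of the planner of record
p3 g4 `rung2/RelLevelWindowCoherence.lean` e2d05236b7c29ba2) asks, at a first blow-up time, for relative-level window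
coherence H₂ in a form that is STRONGER than the door it feeds in three independent respects:
(1) it is ALL-TIMES, while the door W3ᵐᵗ excuses an exceptional time set of final density `θ < 1` (the reason the door
was moved to most-times: ROUND-5/7, misaligned DNS episodes);
(2) it is SIGNED (chord `‖ξx − ξy‖`), while the door and every kit of the route are sign-blind (sine
`√(1 − ⟪ξx, ξy⟫²)`; anti-parallel comparable-amplitude vorticity inside a near-max window violates the chord form and
is invisible to the door);
(3) its modulus `η` is chosen BEFORE the rate constant `κ` (one modulus for all rate floors), while the rung only ever
uses `η` after `κ` is fixed.
This file proves that the weakest pointwise form H₂ʷ — most-times, sine, modulus per `κ`: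
`∃ λ₀ < 1, R₀ > 0, θ < 1 ∀ κ > 0 ∃ η → 0 (at 0⁺), M > 0, E (|E ∩ (T−h,T)| ≤ θh for small h) ∀ t ∈ [0,T) \ E ∀ x y:
 M ≤ |ω(t,x)| → κ/(T−t) ≤ |ω(t,x)| → λ₀|ω(t,x)| ≤ |ω(t,y)| → |x−y| ≤ R₀√(ν/|ω(t,x)|) → x ≠ y →
 √(1 − ⟪ξ(t,x), ξ(t,y)⟫²) ≤ η(‖x − y‖)` —
still gives the door's conclusion at the same solution by the same empty-set argument, is implied by H₂, is killed by
Type I through p5's zoom kit, holds in the regular case, and sits on the hard core exactly like H₂: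

* `mostTimesBulkAlignedAt_of_mostTimesSineCoherenceAt` — THE RUNG for H₂ʷ over an abstract vorticity family (H₂ʷ's
  `λ₀, R₀, θ`; per `κ, ε, δ`: H₂ʷ's `E(κ)` and `M = M(κ) + 4νR₀²/r₀²` with `η(κ) < ε` on `(0,r₀)`; the `ε`-misaligned
  part of the relative top set in the window is EMPTY at every good time);
* `mostTimesSineCoherenceAt_of_relLevelWindowCoherenceAt` — dominance H₂-at ⇒ H₂ʷ-at (`θ = 0`, `E = ∅`, sine ≤ chord,
  also against a vanishing `ω(t,y)`: `sqrt_one_sub_inner_sq_le_norm_sub_of_unit_or_zero`);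
* `mostTimesSineCoherenceAt_of_hasSmoothExtensionPast` — regular case of H₂ʷ (through p3-seat's regular case of H₂);
* `hasSmoothExtensionPast_of_mostTimesSineCoherenceAt_of_typeI` — Type-I kill of H₂ʷ (rung + p5's kit via
  `hasSmoothExtensionPast_of_mostTimesBulkAlignedAt_of_typeI`);
* `mostTimesSineCoherence_doorCalculus` — p1's door calculus instantiated: the Type-I case of H₂ʷ ↔ `ThreadingFlux.Target`
  (stmt-1217) unconditionally; `NoTypeII → (H₂ʷ a priori ↔ Target)`;
* `aprioriMostTimesBulkAlignment_of_aprioriMostTimesSineCoherence` — H₂ʷ a priori ⇒ the crux 19551, BY NAME.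

So the lead may RESHAPE the open stub to H₂ʷ (weaker, hence more plausible as an a-priori statement, same composition,
same print separation: relative-level restriction, T2 row 9) at zero cost; its hard-core location is unchanged
(`blocked-on 1217`). WHAT THIS IS NOT: not NS regularity; nothing here proves H₂ʷ, H₂ or W3ᵐᵗ at a blow-up. [folklore]
-/

noncomputable section
-- the summit and its single sub-problem share the name (CONVENTIONS §1), as in every Theorems file
set_option linter.dupNamespace false

open MeasureTheory Set Function Filter Topology
open scoped RealInnerProductSpace ENNReal
open Literature.Analysis Literature.Analysis.FluidPDE

namespace Summit.NavierStokesRegularity.NavierStokesRegularity.Theorems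

/-! ### Unit-vector geometry: sine below chord, also against the zero vector -/

/-- For a unit vector `a` and a vector `b` that is a unit vector or zero, `√(1 − ⟪a, b⟫²) ≤ ‖a − b‖`
(unit case `sqrt_one_sub_inner_sq_le_norm_sub`; zero case: both sides are `1`). Needed for normalised vorticities
`‖ω‖⁻¹ • ω`, which vanish where `ω = 0`. [folklore] -/
theorem sqrt_one_sub_inner_sq_le_norm_sub_of_unit_or_zero (a b : EuclideanSpace ℝ (Fin 3)) (ha : ‖a‖ = 1)
    (hb : ‖b‖ = 1 ∨ b = 0) : Real.sqrt (1 - ⟪a, b⟫ ^ 2) ≤ ‖a - b‖ := by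
  rcases hb with hb | hb
  · exact sqrt_one_sub_inner_sq_le_norm_sub a b ha hb
  · subst hb
    simp [ha]

/-- The normalised vector `‖v‖⁻¹ • v` is a unit vector or zero. [folklore] -/
theorem norm_normalize_eq_one_or_eq_zero (v : EuclideanSpace ℝ (Fin 3)) :
    ‖‖v‖⁻¹ • v‖ = 1 ∨ ‖v‖⁻¹ • v = 0 := by
  by_cases hv : v = 0
  · right; simp [hv]
  · left; exact norm_smul_inv_norm hv

/-! ### The rung for the weakest pointwise form H₂ʷ -/

/-- **Rung (abstract vorticity family): most-times sine relative-level window coherence ⇒ most-times window bulk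
alignment.** Let `ω : ℝ → ℝ³ → ℝ³`, `ν > 0`. Suppose H₂ʷ at `ω`: `λ₀ < 1`, `R₀ > 0`, `θ < 1` and, for every `κ > 0`, a
modulus `η → 0` at `0⁺`, a threshold `M > 0` and an exceptional time set `E` of final density `≤ θ` such that at every
`t ∈ [0,T) \ E`, every `x` with `M ≤ |ω(t,x)|`, `κ/(T−t) ≤ |ω(t,x)|` and every `y ≠ x` with `λ₀|ω(t,x)| ≤ |ω(t,y)|`,
`|x − y| ≤ R₀√(ν/|ω(t,x)|)`, the SINE of the directions is `≤ η(‖x − y‖)`. Then W3ᵐᵗ's conclusion holds at `ω` with the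
same `λ₀, R₀, θ` and, per `κ, ε, δ`, the same `E` and `M + 4νR₀²/r₀²` (`η < ε` on `(0,r₀)`): the window radius is then
`< r₀`, so the `ε`-misaligned part of the relative top set in the window is EMPTY (for `y = x` the sine is `0`).
The proof is p3-seat's `mostTimesBulkAlignedAt_of_relLevelWindowCoherenceAt` with `E` threaded and the chord step
removed. [folklore] -/
theorem mostTimesBulkAlignedAt_of_mostTimesSineCoherenceAt {ν T : ℝ} (hν : 0 < ν)
    {ω : ℝ → EuclideanSpace ℝ (Fin 3) → EuclideanSpace ℝ (Fin 3)}
    (hH : ∃ lam0 : ℝ, lam0 < 1 ∧ ∃ R0 : ℝ, 0 < R0 ∧ ∃ θ : ℝ, θ < 1 ∧ ∀ κ : ℝ, 0 < κ →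
      ∃ η : ℝ → ℝ, Tendsto η (𝓝[>] 0) (𝓝 0) ∧ ∃ M : ℝ, 0 < M ∧ ∃ E : Set ℝ,
        (∃ h0 : ℝ, 0 < h0 ∧ ∀ h : ℝ, 0 < h → h < h0 →
          volume (E ∩ Set.Ioo (T - h) T) ≤ ENNReal.ofReal (θ * h)) ∧
        ∀ t ∈ Set.Ico 0 T, t ∉ E → ∀ x y : EuclideanSpace ℝ (Fin 3),
          M ≤ ‖ω t x‖ → κ / (T - t) ≤ ‖ω t x‖ → lam0 * ‖ω t x‖ ≤ ‖ω t y‖ →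
          ‖x - y‖ ≤ R0 * Real.sqrt (ν / ‖ω t x‖) → x ≠ y →
          Real.sqrt (1 - (inner ℝ (‖ω t x‖⁻¹ • ω t x) (‖ω t y‖⁻¹ • ω t y)) ^ 2) ≤ η ‖x - y‖) :
    ∃ lam0 : ℝ, lam0 < 1 ∧ ∃ R0 : ℝ, 0 < R0 ∧ ∃ θ : ℝ, θ < 1 ∧ ∀ κ : ℝ, 0 < κ → ∀ ε : ℝ, 0 < ε →
      ∀ δ : ℝ, 0 < δ → ∃ M : ℝ, 0 < M ∧ ∃ E : Set ℝ,
        (∃ h0 : ℝ, 0 < h0 ∧ ∀ h : ℝ, 0 < h → h < h0 →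
          volume (E ∩ Set.Ioo (T - h) T) ≤ ENNReal.ofReal (θ * h)) ∧
        ∀ t ∈ Set.Ico 0 T, t ∉ E → ∀ x : EuclideanSpace ℝ (Fin 3), M ≤ ‖ω t x‖ → κ / (T - t) ≤ ‖ω t x‖ →
          volume {y : EuclideanSpace ℝ (Fin 3) | lam0 * ‖ω t x‖ ≤ ‖ω t y‖ ∧
              ‖x - y‖ ≤ R0 * Real.sqrt (ν / ‖ω t x‖) ∧
              ε < Real.sqrt (1 - (inner ℝ (‖ω t x‖⁻¹ • ω t x) (‖ω t y‖⁻¹ • ω t y)) ^ 2)}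
            ≤ ENNReal.ofReal (δ * Real.sqrt (ν / ‖ω t x‖) ^ 3) := by
  obtain ⟨lam0, hlam0, R0, hR0, θ, hθ, hfam⟩ := hH
  refine ⟨lam0, hlam0, R0, hR0, θ, hθ, ?_⟩
  intro κ hκ ε hε δ _hδ
  obtain ⟨η, hη, M₁, hM₁, E, hE, hmod⟩ := hfam κ hκ
  -- the modulus is below `ε` on a right-neighbourhood `(0, r₀)`
  obtain ⟨r₀, hr₀, hηε⟩ : ∃ r₀ > 0, ∀ s : ℝ, 0 < s → s < r₀ → η s < ε := by
    obtain ⟨r₀, hr₀, h⟩ := Metric.tendsto_nhdsWithin_nhds.mp hη ε hε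
    refine ⟨r₀, hr₀, fun s hs hsr => ?_⟩
    have h1 := h (show s ∈ Ioi (0:ℝ) from hs)
      (by rw [dist_zero_right, Real.norm_eq_abs, abs_of_pos hs]; exact hsr)
    rw [dist_zero_right, Real.norm_eq_abs] at h1
    exact lt_of_abs_lt h1
  have hA : 0 < 4 * ν * R0 ^ 2 / r₀ ^ 2 := by positivity
  refine ⟨M₁ + 4 * ν * R0 ^ 2 / r₀ ^ 2, by positivity, E, hE, ?_⟩
  intro t ht htE x hMx hrate
  have ha0 : 0 < ‖ω t x‖ := lt_of_lt_of_le (by positivity) hMx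
  have hM₁x : M₁ ≤ ‖ω t x‖ := by linarith
  have hMa : 4 * ν * R0 ^ 2 / r₀ ^ 2 ≤ ‖ω t x‖ := by linarith
  have hxa : ω t x ≠ 0 := norm_pos_iff.1 ha0
  have hua : ‖(‖ω t x‖⁻¹ • ω t x)‖ = 1 := norm_smul_inv_norm hxa
  -- the window radius is below `r₀`
  have hwin : R0 * Real.sqrt (ν / ‖ω t x‖) < r₀ := by
    have hq : ν / ‖ω t x‖ ≤ (r₀ / (2 * R0)) ^ 2 := by
      rw [div_le_iff₀ ha0]
      have h1 : 4 * ν * R0 ^ 2 ≤ ‖ω t x‖ * r₀ ^ 2 := by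
        have := (div_le_iff₀ (by positivity : (0:ℝ) < r₀ ^ 2)).1 hMa
        linarith
      have e : (r₀ / (2 * R0)) ^ 2 * ‖ω t x‖ = ‖ω t x‖ * r₀ ^ 2 / (4 * R0 ^ 2) := by
        field_simp
        ring
      rw [e, le_div_iff₀ (by positivity)]
      nlinarith
    have hs : Real.sqrt (ν / ‖ω t x‖) ≤ r₀ / (2 * R0) := by
      calc Real.sqrt (ν / ‖ω t x‖) ≤ Real.sqrt ((r₀ / (2 * R0)) ^ 2) := Real.sqrt_le_sqrt hq
        _ = r₀ / (2 * R0) := Real.sqrt_sq (by positivity)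
    have h2 : R0 * Real.sqrt (ν / ‖ω t x‖) ≤ r₀ / 2 := by
      calc R0 * Real.sqrt (ν / ‖ω t x‖) ≤ R0 * (r₀ / (2 * R0)) := mul_le_mul_of_nonneg_left hs hR0.le
        _ = r₀ / 2 := by field_simp
    linarith
  -- the misaligned part of the relative top set in the window is empty
  have hempty : {y : EuclideanSpace ℝ (Fin 3) | lam0 * ‖ω t x‖ ≤ ‖ω t y‖ ∧
      ‖x - y‖ ≤ R0 * Real.sqrt (ν / ‖ω t x‖) ∧
      ε < Real.sqrt (1 - (inner ℝ (‖ω t x‖⁻¹ • ω t x) (‖ω t y‖⁻¹ • ω t y)) ^ 2)} = ∅ := by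
    refine Set.eq_empty_iff_forall_notMem.2 fun y hy => ?_
    obtain ⟨h1, h2, h3⟩ := hy
    by_cases hxy : x = y
    · -- same point: the sine vanishes, contradicting `ε < sine`
      subst hxy
      have hself : inner ℝ (‖ω t x‖⁻¹ • ω t x) (‖ω t x‖⁻¹ • ω t x) = 1 := by
        rw [real_inner_self_eq_norm_sq, hua]; norm_num
      rw [hself] at h3
      norm_num at h3
      linarith
    · have hpos : 0 < ‖x - y‖ := norm_pos_iff.mpr (sub_ne_zero.mpr hxy)
      have hrad : ‖x - y‖ < r₀ := lt_of_le_of_lt h2 hwin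
      have hsine := hmod t ht htE x y hM₁x hrate h1 h2 hxy
      have hlt : Real.sqrt (1 - (inner ℝ (‖ω t x‖⁻¹ • ω t x) (‖ω t y‖⁻¹ • ω t y)) ^ 2) < ε :=
        lt_of_le_of_lt hsine (hηε _ hpos hrad)
      linarith
  rw [hempty, measure_empty]
  simp

/-! ### Dominance: the registered (all-times, signed, uniform-modulus) H₂ implies H₂ʷ -/

/-- **H₂-at ⇒ H₂ʷ-at** over an abstract vorticity family: the all-times signed clause with one modulus gives the
most-times sine clause with `θ = 0`, `E = ∅` and the same `λ₀, R₀, η, M(κ)` — the sine is below the chord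
(`sqrt_one_sub_inner_sq_le_norm_sub_of_unit_or_zero`; `ξ(t,x)` is a unit vector since `0 < M ≤ |ω(t,x)|`, `ξ(t,y)` is
a unit vector or zero). [folklore] -/
theorem mostTimesSineCoherenceAt_of_relLevelWindowCoherenceAt {ν T : ℝ}
    {ω : ℝ → EuclideanSpace ℝ (Fin 3) → EuclideanSpace ℝ (Fin 3)}
    (hH : ∃ lam0 : ℝ, lam0 < 1 ∧ ∃ R0 : ℝ, 0 < R0 ∧ ∃ η : ℝ → ℝ, Tendsto η (𝓝[>] 0) (𝓝 0) ∧
      ∀ κ : ℝ, 0 < κ → ∃ M : ℝ, 0 < M ∧ ∀ t ∈ Set.Ico 0 T, ∀ x y : EuclideanSpace ℝ (Fin 3),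
        M ≤ ‖ω t x‖ → κ / (T - t) ≤ ‖ω t x‖ → lam0 * ‖ω t x‖ ≤ ‖ω t y‖ →
        ‖x - y‖ ≤ R0 * Real.sqrt (ν / ‖ω t x‖) → x ≠ y →
        ‖(‖ω t x‖⁻¹ • ω t x) - (‖ω t y‖⁻¹ • ω t y)‖ ≤ η ‖x - y‖) :
    ∃ lam0 : ℝ, lam0 < 1 ∧ ∃ R0 : ℝ, 0 < R0 ∧ ∃ θ : ℝ, θ < 1 ∧ ∀ κ : ℝ, 0 < κ →
      ∃ η : ℝ → ℝ, Tendsto η (𝓝[>] 0) (𝓝 0) ∧ ∃ M : ℝ, 0 < M ∧ ∃ E : Set ℝ,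
        (∃ h0 : ℝ, 0 < h0 ∧ ∀ h : ℝ, 0 < h → h < h0 →
          volume (E ∩ Set.Ioo (T - h) T) ≤ ENNReal.ofReal (θ * h)) ∧
        ∀ t ∈ Set.Ico 0 T, t ∉ E → ∀ x y : EuclideanSpace ℝ (Fin 3),
          M ≤ ‖ω t x‖ → κ / (T - t) ≤ ‖ω t x‖ → lam0 * ‖ω t x‖ ≤ ‖ω t y‖ →
          ‖x - y‖ ≤ R0 * Real.sqrt (ν / ‖ω t x‖) → x ≠ y →
          Real.sqrt (1 - (inner ℝ (‖ω t x‖⁻¹ • ω t x) (‖ω t y‖⁻¹ • ω t y)) ^ 2) ≤ η ‖x - y‖ := by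
  obtain ⟨lam0, hlam0, R0, hR0, η, hη, hmod⟩ := hH
  refine ⟨lam0, hlam0, R0, hR0, 0, zero_lt_one, fun κ hκ => ?_⟩
  obtain ⟨M, hM, hM'⟩ := hmod κ hκ
  refine ⟨η, hη, M, hM, ∅, ⟨1, one_pos, fun h _ _ => by simp⟩, ?_⟩
  intro t ht _ x y hMx hrate hrel hwin hxy
  have hx0 : ω t x ≠ 0 := by
    intro h0; rw [h0, norm_zero] at hMx; linarith
  exact (sqrt_one_sub_inner_sq_le_norm_sub_of_unit_or_zero _ _ (norm_smul_inv_norm hx0)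
    (norm_normalize_eq_one_or_eq_zero _)).trans (hM' t ht x y hMx hrate hrel hwin hxy)

/-! ### H₂ʷ at one Navier–Stokes solution: regular case, Type-I kill, hard-core location -/

/-- **Regular case of H₂ʷ.** A classical Leray–Hopf solution from a rapidly decaying datum on `[0,T)` that extends
classically past `T` satisfies H₂ʷ at its vorticity (p3-seat's regular case of H₂,
`relLevelWindowCoherenceAt_of_hasSmoothExtensionPast`, and dominance). [folklore] -/
theorem mostTimesSineCoherenceAt_of_hasSmoothExtensionPast {ν T : ℝ} (hν : 0 < ν) (hT : 0 < T)
    {u : ℝ → EuclideanSpace ℝ (Fin 3) → EuclideanSpace ℝ (Fin 3)}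
    (hLH : IsLerayHopfOn T ν 0 (u 0) u) (hdec : HasRapidSpatialDecay (u 0))
    (hext : HasSmoothExtensionPast ν 0 u T) :
    ∃ lam0 : ℝ, lam0 < 1 ∧ ∃ R0 : ℝ, 0 < R0 ∧ ∃ θ : ℝ, θ < 1 ∧ ∀ κ : ℝ, 0 < κ →
      ∃ η : ℝ → ℝ, Tendsto η (𝓝[>] 0) (𝓝 0) ∧ ∃ M : ℝ, 0 < M ∧ ∃ E : Set ℝ,
        (∃ h0 : ℝ, 0 < h0 ∧ ∀ h : ℝ, 0 < h → h < h0 →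
          volume (E ∩ Set.Ioo (T - h) T) ≤ ENNReal.ofReal (θ * h)) ∧
        ∀ t ∈ Set.Ico 0 T, t ∉ E → ∀ x y : EuclideanSpace ℝ (Fin 3),
          M ≤ ‖curl (u t) x‖ → κ / (T - t) ≤ ‖curl (u t) x‖ → lam0 * ‖curl (u t) x‖ ≤ ‖curl (u t) y‖ →
          ‖x - y‖ ≤ R0 * Real.sqrt (ν / ‖curl (u t) x‖) → x ≠ y →
          Real.sqrt (1 - (inner ℝ (‖curl (u t) x‖⁻¹ • curl (u t) x) (‖curl (u t) y‖⁻¹ • curl (u t) y)) ^ 2)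
            ≤ η ‖x - y‖ :=
  mostTimesSineCoherenceAt_of_relLevelWindowCoherenceAt (ω := fun t => curl (u t))
    (relLevelWindowCoherenceAt_of_hasSmoothExtensionPast hν hT hLH hdec hext)

/-- **Type-I kill of H₂ʷ.** A classical Leray–Hopf solution from a rapidly decaying datum on `[0,T)` with H₂ʷ at its
vorticity and the Type-I rate at `T` extends classically past `T` (rung
`mostTimesBulkAlignedAt_of_mostTimesSineCoherenceAt` + ns-sta-19551-p1's
`hasSmoothExtensionPast_of_mostTimesBulkAlignedAt_of_typeI`, i.e. p5's zoom kit). [folklore] -/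
theorem hasSmoothExtensionPast_of_mostTimesSineCoherenceAt_of_typeI {ν T : ℝ} (hν : 0 < ν) (hT : 0 < T)
    {u : ℝ → EuclideanSpace ℝ (Fin 3) → EuclideanSpace ℝ (Fin 3)} {p : ℝ → EuclideanSpace ℝ (Fin 3) → ℝ}
    (hcl : IsClassicalNSSolutionOn (Ico 0 T) ν 0 u p) (hLH : IsLerayHopfOn T ν 0 (u 0) u)
    (hdec : HasRapidSpatialDecay (u 0))
    (hH : ∃ lam0 : ℝ, lam0 < 1 ∧ ∃ R0 : ℝ, 0 < R0 ∧ ∃ θ : ℝ, θ < 1 ∧ ∀ κ : ℝ, 0 < κ →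
      ∃ η : ℝ → ℝ, Tendsto η (𝓝[>] 0) (𝓝 0) ∧ ∃ M : ℝ, 0 < M ∧ ∃ E : Set ℝ,
        (∃ h0 : ℝ, 0 < h0 ∧ ∀ h : ℝ, 0 < h → h < h0 →
          volume (E ∩ Set.Ioo (T - h) T) ≤ ENNReal.ofReal (θ * h)) ∧
        ∀ t ∈ Set.Ico 0 T, t ∉ E → ∀ x y : EuclideanSpace ℝ (Fin 3),
          M ≤ ‖curl (u t) x‖ → κ / (T - t) ≤ ‖curl (u t) x‖ → lam0 * ‖curl (u t) x‖ ≤ ‖curl (u t) y‖ →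
          ‖x - y‖ ≤ R0 * Real.sqrt (ν / ‖curl (u t) x‖) → x ≠ y →
          Real.sqrt (1 - (inner ℝ (‖curl (u t) x‖⁻¹ • curl (u t) x) (‖curl (u t) y‖⁻¹ • curl (u t) y)) ^ 2)
            ≤ η ‖x - y‖)
    (hI : IsTypeIBlowup u T) : HasSmoothExtensionPast ν 0 u T :=
  hasSmoothExtensionPast_of_mostTimesBulkAlignedAt_of_typeI hν hT hcl hLH hdec
    (mostTimesBulkAlignedAt_of_mostTimesSineCoherenceAt (ω := fun t => curl (u t)) hν hH) hI

/-- **Hard-core location of H₂ʷ (door calculus).** (i) Unconditionally, «H₂ʷ at every classical Leray–Hopf solution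
from a rapidly decaying datum with the Type-I rate at `T`» ↔ `ThreadingFlux.Target` (stmt-NavierStokesRegularity-1217,
no Type-I first blow-up); (ii) given the route's residual `NoTypeII`, «H₂ʷ a priori» ↔ Target. Instance of
ns-sta-19551-p1's `door_iff_target_of_kill_of_regular` with the kill and the regular case above: weakening the physics
stub to H₂ʷ does not change its distance from the hard core. [folklore] -/
theorem mostTimesSineCoherence_doorCalculus :
    ((∀ (ν T : ℝ), 0 < ν → 0 < T → ∀ (u : ℝ → EuclideanSpace ℝ (Fin 3) → EuclideanSpace ℝ (Fin 3))
        (p : ℝ → EuclideanSpace ℝ (Fin 3) → ℝ), IsClassicalNSSolutionOn (Set.Ico 0 T) ν 0 u p →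
        IsLerayHopfOn T ν 0 (u 0) u → HasRapidSpatialDecay (u 0) → IsTypeIBlowup u T →
        ∃ lam0 : ℝ, lam0 < 1 ∧ ∃ R0 : ℝ, 0 < R0 ∧ ∃ θ : ℝ, θ < 1 ∧ ∀ κ : ℝ, 0 < κ →
          ∃ η : ℝ → ℝ, Tendsto η (𝓝[>] 0) (𝓝 0) ∧ ∃ M : ℝ, 0 < M ∧ ∃ E : Set ℝ,
            (∃ h0 : ℝ, 0 < h0 ∧ ∀ h : ℝ, 0 < h → h < h0 →
              volume (E ∩ Set.Ioo (T - h) T) ≤ ENNReal.ofReal (θ * h)) ∧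
            ∀ t ∈ Set.Ico 0 T, t ∉ E → ∀ x y : EuclideanSpace ℝ (Fin 3),
              M ≤ ‖curl (u t) x‖ → κ / (T - t) ≤ ‖curl (u t) x‖ → lam0 * ‖curl (u t) x‖ ≤ ‖curl (u t) y‖ →
              ‖x - y‖ ≤ R0 * Real.sqrt (ν / ‖curl (u t) x‖) → x ≠ y →
              Real.sqrt (1 - (inner ℝ (‖curl (u t) x‖⁻¹ • curl (u t) x) (‖curl (u t) y‖⁻¹ • curl (u t) y)) ^ 2)
                ≤ η ‖x - y‖) ↔
      Summit.NavierStokesRegularity.NavierStokesRegularity.Theses.ThreadingFlux.Target) ∧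
    (Summit.NavierStokesRegularity.NavierStokesRegularity.Theses.ScaledTopAlignment.NoTypeII →
      ((∀ (ν T : ℝ), 0 < ν → 0 < T → ∀ (u : ℝ → EuclideanSpace ℝ (Fin 3) → EuclideanSpace ℝ (Fin 3))
          (p : ℝ → EuclideanSpace ℝ (Fin 3) → ℝ), IsClassicalNSSolutionOn (Set.Ico 0 T) ν 0 u p →
          IsLerayHopfOn T ν 0 (u 0) u → HasRapidSpatialDecay (u 0) →
          ∃ lam0 : ℝ, lam0 < 1 ∧ ∃ R0 : ℝ, 0 < R0 ∧ ∃ θ : ℝ, θ < 1 ∧ ∀ κ : ℝ, 0 < κ →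
            ∃ η : ℝ → ℝ, Tendsto η (𝓝[>] 0) (𝓝 0) ∧ ∃ M : ℝ, 0 < M ∧ ∃ E : Set ℝ,
              (∃ h0 : ℝ, 0 < h0 ∧ ∀ h : ℝ, 0 < h → h < h0 →
                volume (E ∩ Set.Ioo (T - h) T) ≤ ENNReal.ofReal (θ * h)) ∧
              ∀ t ∈ Set.Ico 0 T, t ∉ E → ∀ x y : EuclideanSpace ℝ (Fin 3),
                M ≤ ‖curl (u t) x‖ → κ / (T - t) ≤ ‖curl (u t) x‖ → lam0 * ‖curl (u t) x‖ ≤ ‖curl (u t) y‖ →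
                ‖x - y‖ ≤ R0 * Real.sqrt (ν / ‖curl (u t) x‖) → x ≠ y →
                Real.sqrt (1 - (inner ℝ (‖curl (u t) x‖⁻¹ • curl (u t) x) (‖curl (u t) y‖⁻¹ • curl (u t) y)) ^ 2)
                  ≤ η ‖x - y‖) ↔
        Summit.NavierStokesRegularity.NavierStokesRegularity.Theses.ThreadingFlux.Target)) :=
  door_iff_target_of_kill_of_regular
    (fun _ν _T hν hT _u _p hcl hLH hdec hH hI =>
      hasSmoothExtensionPast_of_mostTimesSineCoherenceAt_of_typeI hν hT hcl hLH hdec hH hI)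
    (fun _ν _T hν hT _u _p _hcl hLH hdec hext =>
      mostTimesSineCoherenceAt_of_hasSmoothExtensionPast hν hT hLH hdec hext)

/-- **H₂ʷ a priori ⇒ the crux W3ᵐᵗ = `AprioriMostTimesBulkAlignment` (stmt-NavierStokesRegularity-19551), BY NAME.**
If every classical Leray–Hopf solution from a rapidly decaying datum on `[0,T)` satisfies H₂ʷ at its vorticity, the
route's deciding crux holds (rung `mostTimesBulkAlignedAt_of_mostTimesSineCoherenceAt`, solution by solution). Together
with `mostTimesSineCoherenceAt_of_relLevelWindowCoherenceAt` this re-derives the registered stub compositions of the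
birth line (two and three stubs) from the weaker physics hypothesis. [folklore] -/
theorem aprioriMostTimesBulkAlignment_of_aprioriMostTimesSineCoherence
    (hA : ∀ (ν T : ℝ), 0 < ν → 0 < T → ∀ (u : ℝ → EuclideanSpace ℝ (Fin 3) → EuclideanSpace ℝ (Fin 3))
        (p : ℝ → EuclideanSpace ℝ (Fin 3) → ℝ), IsClassicalNSSolutionOn (Set.Ico 0 T) ν 0 u p →
        IsLerayHopfOn T ν 0 (u 0) u → HasRapidSpatialDecay (u 0) →
        ∃ lam0 : ℝ, lam0 < 1 ∧ ∃ R0 : ℝ, 0 < R0 ∧ ∃ θ : ℝ, θ < 1 ∧ ∀ κ : ℝ, 0 < κ →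
          ∃ η : ℝ → ℝ, Tendsto η (𝓝[>] 0) (𝓝 0) ∧ ∃ M : ℝ, 0 < M ∧ ∃ E : Set ℝ,
            (∃ h0 : ℝ, 0 < h0 ∧ ∀ h : ℝ, 0 < h → h < h0 →
              volume (E ∩ Set.Ioo (T - h) T) ≤ ENNReal.ofReal (θ * h)) ∧
            ∀ t ∈ Set.Ico 0 T, t ∉ E → ∀ x y : EuclideanSpace ℝ (Fin 3),
              M ≤ ‖curl (u t) x‖ → κ / (T - t) ≤ ‖curl (u t) x‖ → lam0 * ‖curl (u t) x‖ ≤ ‖curl (u t) y‖ →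
              ‖x - y‖ ≤ R0 * Real.sqrt (ν / ‖curl (u t) x‖) → x ≠ y →
              Real.sqrt (1 - (inner ℝ (‖curl (u t) x‖⁻¹ • curl (u t) x) (‖curl (u t) y‖⁻¹ • curl (u t) y)) ^ 2)
                ≤ η ‖x - y‖) :
    Summit.NavierStokesRegularity.NavierStokesRegularity.Theses.ScaledTopAlignment.AprioriMostTimesBulkAlignment :=
  fun ν T hν hT u p hcl hLH hdec =>
    mostTimesBulkAlignedAt_of_mostTimesSineCoherenceAt (ω := fun t => curl (u t)) hν (hA ν T hν hT u p hcl hLH hdec)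

end Summit.NavierStokesRegularity.NavierStokesRegularity.Theorems

end
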